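import Mathlib
import Literature.NumberTheory.LFunctions.NumHelpers
import Summits.QuantumFields.BalabanUV.Beta.EriceRemainderEnclosureHistoryAutonomyComparisonAgeCompositionStaticChainWindowBounds
import Summits.QuantumFields.BalabanUV.Beta.EriceRemainderEnclosureHistoryAutonomyComparisonAgeCompositionStaticChainResolvent

/-!
# EriceRemainderEnclosureHistoryAutonomyComparisonAgeCompositionStaticChainAdjacentEnvelopes — (E78e) THE LATTICE ENVELOPES behind the adjacent certificate
# (E78d), part 1: for every adjacent pair `(z+1, z)` with `z ≥ 16` the read-window constants satisfy `σ ∈ [0.7704, 0.8285]`, `φ ∈ [0.8284, 0.8723]`, `s ≥ 0.8117`,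
# and the structural constants obey `λ₁ ≥ 1.3725`, `λ₂ ≥ 1.6568` for EVERY scale — all from the closed forms already in the tree (part 2, (E78f)
# `…AdjacentRatioEnvelopes`: `β ≤ 1.0607`, the reverse covariance bound, `θ̄ ≤ 0.7856`)

Cell `pub-balaban`, β-function sub-cell, BINDER row D4 «RemainderConst leaves for Bałaban's split» (`HOME/BINDER-OWNERS.md`; owner lineage `b2b-balaban-beta-an4`;
this file by co-owner #2 lineage `b2b-balaban-beta-d4-p2`, generation 69), β-FLOW TEAM duty (1), FREEZE (0) honoured (def-free; imports `…StaticChainWindowBounds`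
(`le_readWindow_ratio`, `readWindow_le_ratio`, `readWindow_self_le`), (E78b) `…StaticChainResolvent`
(`readWindow_mono_right`) and `Literature.NumberTheory.LFunctions.NumHelpers` (`sqrt_le_of_le_sq`, `le_sqrt_of_sq_le`); nothing restated).

HONEST FRAMING (page 1, verbatim and binding).  *"Discharging BetaPertH makes Bałaban's UV stability UNCONDITIONAL — a real constructive-QFT result; it is
NOT the continuum limit and NOT the Clay problem."*  THIS FILE DISCHARGES NOTHING OF THE KIND.  Elementary real analysis — square roots, one exponential constant,
finite sums — hypotheses of a census, not facts; the age profile of Bałaban's (1.22) limit functional is NOT PRINTED ([I] p. 298; GAPS G-t4-U2-1∕-2) and NOT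
asserted.  Row D4 class UNCHANGED (critical-path width 0; instance 0∕1; D4 DISCHARGE NO DATE).  HONEST DEPENDENCY: continuum YM on T⁴ ⇐ BetaPertH ∧ nine spine
estimates (0/9 proved); BetaPertH ⇐ (D1) ∧ (D4) ∧ CAP+tail; G-an2-4 gates asym, D1 and NE2/3/4.

THE POINT (census sense (α); route (N′); README `HOME/b2b-balaban-beta-d4-p2/g69/e78/README.md` §6 (1)).  (E78d) `adjacent_F_nonneg_crude` ∕ `adjacent_G_nonneg_crude`
prove the observer step for every adjacent pair `z ≥ 16` GIVEN numeric envelopes of the geometry constants.  This file PROVES those envelopes on the lattice: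
§1 a square-root toolkit (`sqrt_add_le`: `√(a+ε) ≤ √a + ε∕(2√a)`; the gap `√(2+ε) − √(1+ε)` is non-increasing and `≥ 1∕(√2 + 1 + 0.8536ε)`; seven-digit `√2`);
§2 `sigma_ge`∕`sigma_le` (`0.7704(z+1) ≤ S_{z+1,z} ≤ 0.8285(z+1)`, `z ≥ 16`), `phi_ge`∕`phi_le` (`0.8284z ≤ S_{z,z+1} ≤ 0.8723z`), `self_ge` (`S_{n,n} ≥ 0.8117n`,
`n ≥ 17`); §3 the structural constants for EVERY scale `y ≥ 1`: **`lam2_ge`** (`2S_{y+1,y+1} ≥ 1.6568y`) and **`lam1_ge`** (`2S_{y,y+1}S_{y+1,y} ≥ 1.3725y²` —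
the exact identity `(√2 − √(1+ε))(√2 + √(1+ε)) = y∕(y+1)` absorbs the factor `(y+1)(1−ε) = y`).  Together with (E78f) (`β ≤ 1.0607`, reverse covariance,
`θ̄ ≤ 0.7856`), (E78c) `charge_ratio_ge` (`α_k ≥ z∕(z+1) ≥ 16∕17`), `readWindow_mono_right` (`α_k ≤ 1`), `read_ratio_ge` (`β_k ≥ 1`) and (E78b)
`return_amplification_ge_lattice`, every hypothesis of the crude adjacent certificate becomes a tree theorem for `z ≥ 16` (README §6).  NOT CLAIMED: the wiring
as a single theorem; the pairs `z ≤ 15`; non-adjacent pairs; the assembly of the induction; the static closure; anything about the flow; printed.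

WHAT IS PROVED ([folklore]; 0 `def`, 0 sorry).  §1 `sqrt_two_bounds`, `sqrt_add_le`, `gap_antitone`, `gap_seventeenth`.  §2
**`sigma_ge`**, `sigma_le`, **`phi_ge`**, `phi_le`, **`self_ge`**.  §3 `gap_ge_inv`, **`lam2_ge`**, **`lam1_ge`**.
-/
noncomputable section
open Finset

namespace Summit.QuantumFields.BalabanUV.Beta.EriceRemainderEnclosureHistoryAutonomyComparisonAgeCompositionStaticChainAdjacentEnvelopes

open Summit.QuantumFields.BalabanUV.Beta.EriceRemainderEnclosureHistoryAutonomyComparisonAgeCompositionStaticChainWindowBounds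
open Summit.QuantumFields.BalabanUV.Beta.EriceRemainderEnclosureHistoryAutonomyComparisonAgeCompositionStaticChainWindowMass
open Summit.QuantumFields.BalabanUV.Beta.EriceRemainderEnclosureHistoryAutonomyComparisonAgeCompositionStaticChainResolvent

open Literature.NumberTheory.LFunctions.VdC.Num (sqrt_le_of_le_sq le_sqrt_of_sq_le)

/-! ## §1 Square-root toolkit -/

/-- Seven-digit brackets of `√2`. [folklore] -/
theorem sqrt_two_bounds : (14142135 / 10000000 : ℝ) ≤ Real.sqrt 2 ∧ Real.sqrt 2 ≤ 14142136 / 10000000 :=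
  ⟨le_sqrt_of_sq_le (by norm_num) (by norm_num), sqrt_le_of_le_sq (by norm_num) (by norm_num)⟩

/-- Concavity of the square root at first order: `√(a+ε) ≤ √a + ε∕(2√a)` (`a > 0`, `ε ≥ 0`). [folklore] -/
theorem sqrt_add_le {a ε : ℝ} (ha : 0 < a) (hε : 0 ≤ ε) : Real.sqrt (a + ε) ≤ Real.sqrt a + ε / (2 * Real.sqrt a) := by
  have hs : 0 < Real.sqrt a := Real.sqrt_pos.mpr ha
  have hsq : Real.sqrt a * Real.sqrt a = a := Real.mul_self_sqrt ha.le
  apply sqrt_le_of_le_sq (by positivity)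
  have : (Real.sqrt a + ε / (2 * Real.sqrt a)) ^ 2 = a + ε + (ε / (2 * Real.sqrt a)) ^ 2 := by
    field_simp
    nlinarith [hsq]
  rw [this]; nlinarith [sq_nonneg (ε / (2 * Real.sqrt a))]

/-- The gap `g(ε) = √(2+ε) − √(1+ε)` is non-increasing: for `0 ≤ ε ≤ ε₀`, `g(ε₀) ≤ g(ε)` (it equals `1∕(√(2+ε) + √(1+ε))`). [folklore] -/
theorem gap_antitone {ε ε₀ : ℝ} (hε : 0 ≤ ε) (hεε : ε ≤ ε₀) :
    Real.sqrt (2 + ε₀) - Real.sqrt (1 + ε₀) ≤ Real.sqrt (2 + ε) - Real.sqrt (1 + ε) := by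
  have h2 : Real.sqrt (2 + ε) ≤ Real.sqrt (2 + ε₀) := Real.sqrt_le_sqrt (by linarith)
  have h1 : Real.sqrt (1 + ε) ≤ Real.sqrt (1 + ε₀) := Real.sqrt_le_sqrt (by linarith)
  have hA : Real.sqrt (2 + ε) * Real.sqrt (2 + ε) = 2 + ε := Real.mul_self_sqrt (by linarith)
  have hB : Real.sqrt (1 + ε) * Real.sqrt (1 + ε) = 1 + ε := Real.mul_self_sqrt (by linarith)
  have hA0 : Real.sqrt (2 + ε₀) * Real.sqrt (2 + ε₀) = 2 + ε₀ := Real.mul_self_sqrt (by linarith)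
  have hB0 : Real.sqrt (1 + ε₀) * Real.sqrt (1 + ε₀) = 1 + ε₀ := Real.mul_self_sqrt (by linarith)
  have hp1 : 0 < Real.sqrt (1 + ε) := Real.sqrt_pos.mpr (by linarith)
  have hp2 : 0 < Real.sqrt (2 + ε) := Real.sqrt_pos.mpr (by linarith)
  -- `g(ε)(√(2+ε)+√(1+ε)) = 1 = g(ε₀)(√(2+ε₀)+√(1+ε₀))` and the second bracket is larger
  have e1 : (Real.sqrt (2 + ε) - Real.sqrt (1 + ε)) * (Real.sqrt (2 + ε) + Real.sqrt (1 + ε)) = 1 := by nlinarith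
  have e0 : (Real.sqrt (2 + ε₀) - Real.sqrt (1 + ε₀)) * (Real.sqrt (2 + ε₀) + Real.sqrt (1 + ε₀)) = 1 := by nlinarith
  have hsum : Real.sqrt (2 + ε) + Real.sqrt (1 + ε) ≤ Real.sqrt (2 + ε₀) + Real.sqrt (1 + ε₀) := by linarith
  have hS : 0 < Real.sqrt (2 + ε) + Real.sqrt (1 + ε) := by linarith
  have hg0 : 0 ≤ Real.sqrt (2 + ε₀) - Real.sqrt (1 + ε₀) := by
    have : Real.sqrt (1 + ε₀) ≤ Real.sqrt (2 + ε₀) := Real.sqrt_le_sqrt (by linarith)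
    linarith
  by_contra hcon
  have hcon' : Real.sqrt (2 + ε) - Real.sqrt (1 + ε) < Real.sqrt (2 + ε₀) - Real.sqrt (1 + ε₀) := not_le.mp hcon
  have : (Real.sqrt (2 + ε) - Real.sqrt (1 + ε)) * (Real.sqrt (2 + ε) + Real.sqrt (1 + ε))
      < (Real.sqrt (2 + ε₀) - Real.sqrt (1 + ε₀)) * (Real.sqrt (2 + ε₀) + Real.sqrt (1 + ε₀)) :=
    calc (Real.sqrt (2 + ε) - Real.sqrt (1 + ε)) * (Real.sqrt (2 + ε) + Real.sqrt (1 + ε))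
        < (Real.sqrt (2 + ε₀) - Real.sqrt (1 + ε₀)) * (Real.sqrt (2 + ε) + Real.sqrt (1 + ε)) := mul_lt_mul_of_pos_right hcon' hS
      _ ≤ (Real.sqrt (2 + ε₀) - Real.sqrt (1 + ε₀)) * (Real.sqrt (2 + ε₀) + Real.sqrt (1 + ε₀)) := mul_le_mul_of_nonneg_left hsum hg0
  linarith

/-- The gap at `ε = 1∕17`: `√(35∕17) − √(18∕17) ≥ 0.405859`. [folklore] -/
theorem gap_seventeenth : (405859 / 1000000 : ℝ) ≤ Real.sqrt (2 + 1 / 17) - Real.sqrt (1 + 1 / 17) := by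
  have h1 : (1434860 / 1000000 : ℝ) ≤ Real.sqrt (2 + 1 / 17) := le_sqrt_of_sq_le (by norm_num) (by norm_num)
  have h2 : Real.sqrt (1 + 1 / 17) ≤ 1028993 / 1000000 := sqrt_le_of_le_sq (by norm_num) (by norm_num)
  linarith

/-! ## §2 Envelopes of the read-window constants for adjacent pairs `(z+1, z)`, `z ≥ 16` -/

/-- **`σ ≥ 0.7704`**: `S_{z+1,z} ≥ (963∕1250)(z+1)` for `z ≥ 16` (`le_readWindow_ratio`: `S_{z+1,z} ≥ 2(z+1)(√2 − √(1+1∕(z+1)))`). [folklore] -/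
theorem sigma_ge {z : ℕ} (hz : 16 ≤ z) :
    (963 / 1250 : ℝ) * ((z : ℝ) + 1) ≤ ∑ l ∈ range z, Real.sqrt (((z : ℝ) + 1) / (((z : ℝ) + 1) + l + 1)) := by
  have hz' : (16 : ℝ) ≤ z := by exact_mod_cast hz
  have hk : (0 : ℝ) < (z : ℝ) + 1 := by positivity
  have h := le_readWindow_ratio hk z
  have e1 : (1 : ℝ) + ((z : ℝ) + 1) / ((z : ℝ) + 1) = 2 := by field_simp; ring
  rw [e1] at h
  have hε : 1 / ((z : ℝ) + 1) ≤ 1 / 17 := by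
    rw [div_le_div_iff₀ hk (by norm_num)]; linarith
  have hs : Real.sqrt (1 + 1 / ((z : ℝ) + 1)) ≤ 1028993 / 1000000 :=
    le_trans (Real.sqrt_le_sqrt (by linarith)) (sqrt_le_of_le_sq (by norm_num) (by norm_num : (1:ℝ) + 1 / 17 ≤ (1028993 / 1000000) ^ 2))
  have h2 := sqrt_two_bounds.1
  nlinarith

/-- **`σ ≤ 0.8285`**: `S_{z+1,z} ≤ S_{z+1,z+1} ≤ 2(√2−1)(z+1) ≤ (1657∕2000)(z+1)` (`readWindow_mono_right`, `readWindow_self_le`). [folklore] -/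
theorem sigma_le (z : ℕ) :
    ∑ l ∈ range z, Real.sqrt (((z : ℝ) + 1) / (((z : ℝ) + 1) + l + 1)) ≤ (1657 / 2000 : ℝ) * ((z : ℝ) + 1) := by
  have h1 := readWindow_mono_right (((z : ℝ) + 1)) (Nat.le_succ z)
  have h2 := readWindow_self_le (j := z + 1) (by omega)
  push_cast at h2
  have h3 := sqrt_two_bounds.2
  have hz : (0:ℝ) ≤ z := Nat.cast_nonneg z
  nlinarith

/-- **`φ ≥ 0.8284`**: `S_{z,z+1} ≥ 2z√(1+1∕z)(√2−1) ≥ (2071∕2500)z` for `z ≥ 1` (`le_readWindow_ratio`). [folklore] -/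
theorem phi_ge {z : ℕ} (hz : 1 ≤ z) :
    (2071 / 2500 : ℝ) * (z : ℝ) ≤ ∑ l ∈ range (z + 1), Real.sqrt ((z : ℝ) / ((z : ℝ) + l + 1)) := by
  have hz' : (1 : ℝ) ≤ z := by exact_mod_cast hz
  have hk : (0 : ℝ) < (z : ℝ) := by positivity
  have h := le_readWindow_ratio hk (z + 1)
  push_cast at h
  have e1 : (1 : ℝ) + ((z : ℝ) + 1 + 1) / (z : ℝ) = 2 * (1 + 1 / (z : ℝ)) := by field_simp; ring
  rw [e1, Real.sqrt_mul (by norm_num)] at h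
  set u := Real.sqrt (1 + 1 / (z : ℝ)) with hu
  have hu1 : 1 ≤ u := by
    rw [hu]; apply le_sqrt_of_sq_le (by norm_num)
    have : 0 ≤ 1 / (z:ℝ) := by positivity
    linarith
  have h2 := sqrt_two_bounds.1
  -- `2 z (√2·u − u) = 2 z u (√2 − 1) ≥ 2 z (√2 − 1)`
  nlinarith [mul_nonneg hk.le (sub_nonneg.mpr hu1), mul_le_mul_of_nonneg_left hu1 hk.le]

/-- **`φ ≤ 0.8723`**: `S_{z,z+1} ≤ 2z(√(2+1∕z) − 1) ≤ (8723∕10000)z` for `z ≥ 16` (`readWindow_le_ratio`). [folklore] -/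
theorem phi_le {z : ℕ} (hz : 16 ≤ z) :
    ∑ l ∈ range (z + 1), Real.sqrt ((z : ℝ) / ((z : ℝ) + l + 1)) ≤ (8723 / 10000 : ℝ) * (z : ℝ) := by
  have hz' : (16 : ℝ) ≤ z := by exact_mod_cast hz
  have hk : (0 : ℝ) < (z : ℝ) := by positivity
  have h := readWindow_le_ratio hk (z + 1)
  push_cast at h
  have e1 : (1 : ℝ) + ((z : ℝ) + 1) / (z : ℝ) = 2 + 1 / (z : ℝ) := by field_simp; ring
  rw [e1] at h
  have hε : 1 / (z : ℝ) ≤ 1 / 16 := by rw [div_le_div_iff₀ hk (by norm_num)]; linarith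
  have hs : Real.sqrt (2 + 1 / (z : ℝ)) ≤ 143615 / 100000 :=
    le_trans (Real.sqrt_le_sqrt (by linarith)) (sqrt_le_of_le_sq (by norm_num) (by norm_num : (2:ℝ) + 1 / 16 ≤ (143615 / 100000) ^ 2))
  nlinarith

/-- **`s ≥ 0.8117`**: `S_{n,n} ≥ 2n(√(2+1∕n) − √(1+1∕n)) ≥ (8117∕10000)n` for `n ≥ 17` (`le_readWindow_ratio`, `gap_antitone`, `gap_seventeenth`). [folklore] -/
theorem self_ge {n : ℕ} (hn : 17 ≤ n) :
    (8117 / 10000 : ℝ) * (n : ℝ) ≤ ∑ l ∈ range n, Real.sqrt ((n : ℝ) / ((n : ℝ) + l + 1)) := by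
  have hn' : (17 : ℝ) ≤ n := by exact_mod_cast hn
  have hk : (0 : ℝ) < (n : ℝ) := by positivity
  have h := le_readWindow_ratio hk n
  have e1 : (1 : ℝ) + ((n : ℝ) + 1) / (n : ℝ) = 2 + 1 / (n : ℝ) := by field_simp; ring
  rw [e1] at h
  have hε : 1 / (n : ℝ) ≤ 1 / 17 := by rw [div_le_div_iff₀ hk (by norm_num)]; linarith
  have hg := gap_antitone (by positivity : (0:ℝ) ≤ 1 / (n : ℝ)) hε
  have hg17 := gap_seventeenth
  nlinarith

/-! ## §3 The structural constants `λ₁ ≥ 1.3725`, `λ₂ ≥ 1.6568` for every scale `y ≥ 1` -/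

/-- Lower bound of the gap through first-order concavity: `√(2+ε) − √(1+ε) ≥ 1∕(√2 + 1 + (1∕(2√2) + 1∕2)ε)` for `ε ≥ 0`. [folklore] -/
theorem gap_ge_inv {ε : ℝ} (hε : 0 ≤ ε) :
    1 / (Real.sqrt 2 + 1 + (1 / (2 * Real.sqrt 2) + 1 / 2) * ε) ≤ Real.sqrt (2 + ε) - Real.sqrt (1 + ε) := by
  have hA : Real.sqrt (2 + ε) * Real.sqrt (2 + ε) = 2 + ε := Real.mul_self_sqrt (by linarith)
  have hB : Real.sqrt (1 + ε) * Real.sqrt (1 + ε) = 1 + ε := Real.mul_self_sqrt (by linarith)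
  have hp1 : 0 < Real.sqrt (1 + ε) := Real.sqrt_pos.mpr (by linarith)
  have hp2 : 0 < Real.sqrt (2 + ε) := Real.sqrt_pos.mpr (by linarith)
  have e1 : (Real.sqrt (2 + ε) - Real.sqrt (1 + ε)) = 1 / (Real.sqrt (2 + ε) + Real.sqrt (1 + ε)) := by
    rw [eq_div_iff (by linarith)]; nlinarith
  rw [e1]
  have hs2 : 0 < Real.sqrt 2 := Real.sqrt_pos.mpr (by norm_num)
  have h2 : Real.sqrt (2 + ε) ≤ Real.sqrt 2 + ε / (2 * Real.sqrt 2) := sqrt_add_le (by norm_num) hε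
  have h1 : Real.sqrt (1 + ε) ≤ Real.sqrt 1 + ε / (2 * Real.sqrt 1) := sqrt_add_le (by norm_num) hε
  rw [Real.sqrt_one] at h1
  apply one_div_le_one_div_of_le (by linarith)
  have : ε / (2 * Real.sqrt 2) = 1 / (2 * Real.sqrt 2) * ε := by ring
  nlinarith

/-- **`λ₂ = 2S_{y+1,y+1}∕y ≥ 2071∕1250`** for every `y ≥ 1`: `(2071∕1250)·y ≤ 2 S_{y+1,y+1}`. [folklore] -/
theorem lam2_ge {y : ℕ} (hy : 1 ≤ y) :
    (2071 / 1250 : ℝ) * (y : ℝ) ≤ 2 * ∑ l ∈ range (y + 1), Real.sqrt (((y : ℝ) + 1) / (((y : ℝ) + 1) + l + 1)) := by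
  have hy' : (1 : ℝ) ≤ y := by exact_mod_cast hy
  have hk : (0 : ℝ) < (y : ℝ) + 1 := by positivity
  have h := le_readWindow_ratio hk (y + 1)
  push_cast at h
  have e1 : (1 : ℝ) + ((y : ℝ) + 1 + 1) / ((y : ℝ) + 1) = 2 + 1 / ((y : ℝ) + 1) := by field_simp; ring
  rw [e1] at h
  have hg := gap_ge_inv (by positivity : (0:ℝ) ≤ 1 / ((y : ℝ) + 1))
  obtain ⟨hl, hu⟩ := sqrt_two_bounds
  have hs2 : 0 < Real.sqrt 2 := by linarith
  -- `c = 1/(2√2) + 1/2 ≤ 0.853554`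
  have hc : 1 / (2 * Real.sqrt 2) + 1 / 2 ≤ (853554 / 1000000 : ℝ) := by
    have : 1 / (2 * Real.sqrt 2) ≤ 353554 / 1000000 := by
      rw [div_le_iff₀ (by positivity)]; nlinarith
    linarith
  have hden : 0 < Real.sqrt 2 + 1 + (1 / (2 * Real.sqrt 2) + 1 / 2) * (1 / ((y:ℝ) + 1)) := by positivity
  -- `2 S ≥ 4(y+1) g ≥ 4(y+1) / (√2 + 1 + c/(y+1))` and `4(y+1) ≥ (2071/1250) y (√2 + 1 + c/(y+1))`
  have hkey : (2071 / 1250 : ℝ) * y * (Real.sqrt 2 + 1 + (1 / (2 * Real.sqrt 2) + 1 / 2) * (1 / ((y:ℝ) + 1))) ≤ 4 * ((y:ℝ) + 1) := by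
    have h3 : (1 / (2 * Real.sqrt 2) + 1 / 2) * (1 / ((y:ℝ) + 1)) ≤ (853554 / 1000000 : ℝ) * (1 / ((y:ℝ) + 1)) :=
      mul_le_mul_of_nonneg_right hc (by positivity)
    have hc0 : 0 ≤ 1 / (2 * Real.sqrt 2) + 1 / 2 := by positivity
    have hyfrac : (y:ℝ) * (1 / ((y:ℝ) + 1)) ≤ 1 := by rw [mul_one_div, div_le_one hk]; linarith
    have hy0 : (0:ℝ) ≤ y := by linarith
    have t1 : (2071 / 1250 : ℝ) * y * (Real.sqrt 2 + 1) ≤ (39999 / 10000 : ℝ) * y := by nlinarith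
    have t2 : (2071 / 1250 : ℝ) * y * ((1 / (2 * Real.sqrt 2) + 1 / 2) * (1 / ((y:ℝ) + 1))) ≤ (2071 / 1250 : ℝ) * (853554 / 1000000) := by
      have : (2071 / 1250 : ℝ) * y * ((1 / (2 * Real.sqrt 2) + 1 / 2) * (1 / ((y:ℝ) + 1)))
          = (2071 / 1250 : ℝ) * ((1 / (2 * Real.sqrt 2) + 1 / 2) * ((y:ℝ) * (1 / ((y:ℝ) + 1)))) := by ring
      rw [this]
      have h5 : (1 / (2 * Real.sqrt 2) + 1 / 2) * ((y:ℝ) * (1 / ((y:ℝ) + 1))) ≤ (853554 / 1000000 : ℝ) * 1 :=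
        mul_le_mul hc hyfrac (by positivity) (by norm_num)
      nlinarith
    nlinarith
  have hg2 : 4 * ((y:ℝ) + 1) / (Real.sqrt 2 + 1 + (1 / (2 * Real.sqrt 2) + 1 / 2) * (1 / ((y:ℝ) + 1)))
      ≤ 2 * (2 * ((y:ℝ) + 1) * (Real.sqrt (2 + 1 / ((y:ℝ) + 1)) - Real.sqrt (1 + 1 / ((y:ℝ) + 1)))) := by
    rw [div_eq_mul_one_div]
    have := mul_le_mul_of_nonneg_left hg (by positivity : (0:ℝ) ≤ 4 * ((y:ℝ) + 1))
    linarith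
  have hfin : (2071 / 1250 : ℝ) * y ≤ 4 * ((y:ℝ) + 1) / (Real.sqrt 2 + 1 + (1 / (2 * Real.sqrt 2) + 1 / 2) * (1 / ((y:ℝ) + 1))) := by
    rw [le_div_iff₀ hden]; exact hkey
  linarith

/-- **`λ₁ = 2S_{y,y+1}S_{y+1,y}∕y² ≥ 549∕400`** for every `y ≥ 1`: `(549∕400)·y² ≤ 2 S_{y,y+1} S_{y+1,y}`. [folklore] -/
theorem lam1_ge {y : ℕ} (hy : 1 ≤ y) :
    (549 / 400 : ℝ) * (y : ℝ) ^ 2 ≤ 2 * (∑ l ∈ range (y + 1), Real.sqrt ((y : ℝ) / ((y : ℝ) + l + 1)))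
      * (∑ l ∈ range y, Real.sqrt (((y : ℝ) + 1) / (((y : ℝ) + 1) + l + 1))) := by
  have hy' : (1 : ℝ) ≤ y := by exact_mod_cast hy
  have hk : (0 : ℝ) < (y : ℝ) := by positivity
  have hk1 : (0 : ℝ) < (y : ℝ) + 1 := by positivity
  obtain ⟨hl, hu⟩ := sqrt_two_bounds
  -- first factor: `S_{y,y+1} ≥ 2 y u (√2 − 1)`, `u = √(1+1/y) ≥ 1 + 1/(3y)`
  have hA := le_readWindow_ratio hk (y + 1)
  push_cast at hA
  have e1 : (1 : ℝ) + ((y : ℝ) + 1 + 1) / (y : ℝ) = 2 * (1 + 1 / (y : ℝ)) := by field_simp; ring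
  rw [e1, Real.sqrt_mul (by norm_num)] at hA
  set u := Real.sqrt (1 + 1 / (y : ℝ)) with hu_def
  have hu1 : 1 + 1 / (3 * (y:ℝ)) ≤ u := by
    rw [hu_def]; apply le_sqrt_of_sq_le (by positivity)
    have : (1 + 1 / (3 * (y:ℝ))) ^ 2 = 1 + 2 / (3 * y) + 1 / (9 * y ^ 2) := by field_simp; ring
    rw [this]
    have h9 : 1 / (9 * (y:ℝ) ^ 2) ≤ 1 / (3 * y) := by
      rw [div_le_div_iff₀ (by positivity) (by positivity)]; nlinarith
    have e9 : 2 / (3 * (y:ℝ)) + 1 / (3 * y) = 1 / y := by field_simp; ring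
    linarith
  -- second factor: `S_{y+1,y} ≥ 2(y+1)(√2 − √(1+ε)) = 2(y+1)(1−ε)/(√2+√(1+ε)) ≥ 2y/(√2 + 1 + ε/2)`, `ε = 1/(y+1)`
  have hB := le_readWindow_ratio hk1 y
  have e2 : (1 : ℝ) + ((y : ℝ) + 1) / ((y : ℝ) + 1) = 2 := by field_simp; ring
  rw [e2] at hB
  set v := Real.sqrt (1 + 1 / ((y : ℝ) + 1)) with hv_def
  have hv : v ≤ 1 + 1 / (2 * ((y:ℝ) + 1)) := by
    rw [hv_def]; apply sqrt_le_of_le_sq (by positivity)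
    have ea : 1 / ((y:ℝ) + 1) = 2 * (1 / (2 * ((y:ℝ) + 1))) := by field_simp
    nlinarith [sq_nonneg (1 / (2 * ((y:ℝ) + 1))), ea]
  have hvv : v * v = 1 + 1 / ((y : ℝ) + 1) := by rw [hv_def]; exact Real.mul_self_sqrt (by positivity)
  have hv0 : 0 < v := by rw [hv_def]; exact Real.sqrt_pos.mpr (by positivity)
  -- `(√2 − v)(√2 + v) = 1 − 1/(y+1) = y/(y+1)`
  have hprod : (Real.sqrt 2 - v) * (Real.sqrt 2 + v) = (y:ℝ) / ((y:ℝ) + 1) := by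
    have h22 : Real.sqrt 2 * Real.sqrt 2 = 2 := Real.mul_self_sqrt (by norm_num)
    have e : (Real.sqrt 2 - v) * (Real.sqrt 2 + v) = Real.sqrt 2 * Real.sqrt 2 - v * v := by ring
    rw [e, h22, hvv]; field_simp; ring
  have hden : 0 < Real.sqrt 2 + v := by linarith
  have hSv : (y:ℝ) / ((y:ℝ) + 1) / (Real.sqrt 2 + v) = Real.sqrt 2 - v := by
    rw [div_eq_iff hden.ne', hprod]
  -- assemble: `S₁ ≥ 2y(√2−1)(1 + 1/(3y))`, `S₂ ≥ 2(y+1)(√2 − v) = 2y/(√2+v) ≥ 2y/(√2 + 1 + 1/(2(y+1)))`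
  have hS1 : 2 * (y:ℝ) * (Real.sqrt 2 - 1) * (1 + 1 / (3 * (y:ℝ))) ≤ ∑ l ∈ range (y + 1), Real.sqrt ((y : ℝ) / ((y : ℝ) + l + 1)) := by
    have : 2 * (y:ℝ) * (Real.sqrt 2 * u - u) = 2 * (y:ℝ) * (Real.sqrt 2 - 1) * u := by ring
    rw [this] at hA
    exact le_trans (mul_le_mul_of_nonneg_left hu1 (by nlinarith)) hA
  have hS2 : 2 * (y:ℝ) / (Real.sqrt 2 + 1 + 1 / (2 * ((y:ℝ) + 1))) ≤ ∑ l ∈ range y, Real.sqrt (((y : ℝ) + 1) / (((y : ℝ) + 1) + l + 1)) := by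
    have h1 : 2 * (y:ℝ) / (Real.sqrt 2 + 1 + 1 / (2 * ((y:ℝ) + 1))) ≤ 2 * (y:ℝ) / (Real.sqrt 2 + v) :=
      div_le_div_of_nonneg_left (by positivity) hden (by linarith)
    have h2 : 2 * (y:ℝ) / (Real.sqrt 2 + v) = 2 * ((y:ℝ) + 1) * (Real.sqrt 2 - v) := by
      rw [← hSv]; field_simp
    linarith [h1, h2.le, h2.ge]
  -- numeric comparison: `2·[2y(√2−1)(1+1/(3y))]·[2y/(√2+1+1/(2(y+1)))] ≥ (549/400) y²`
  have hpos1 : 0 ≤ 2 * (y:ℝ) * (Real.sqrt 2 - 1) * (1 + 1 / (3 * (y:ℝ))) := by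
    have : 0 ≤ Real.sqrt 2 - 1 := by linarith
    positivity
  have hpos2 : 0 ≤ 2 * (y:ℝ) / (Real.sqrt 2 + 1 + 1 / (2 * ((y:ℝ) + 1))) := by positivity
  have hprodS := mul_le_mul hS1 hS2 hpos2 (le_trans hpos1 hS1)
  have hD : 0 < Real.sqrt 2 + 1 + 1 / (2 * ((y:ℝ) + 1)) := by positivity
  have hnum : (549 / 400 : ℝ) * (y:ℝ) ^ 2 ≤ 2 * ((2 * (y:ℝ) * (Real.sqrt 2 - 1) * (1 + 1 / (3 * (y:ℝ)))) * (2 * (y:ℝ) / (Real.sqrt 2 + 1 + 1 / (2 * ((y:ℝ) + 1))))) := by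
    rw [show 2 * ((2 * (y:ℝ) * (Real.sqrt 2 - 1) * (1 + 1 / (3 * (y:ℝ)))) * (2 * (y:ℝ) / (Real.sqrt 2 + 1 + 1 / (2 * ((y:ℝ) + 1)))))
        = (8 * (y:ℝ) ^ 2 * (Real.sqrt 2 - 1) * (1 + 1 / (3 * (y:ℝ)))) / (Real.sqrt 2 + 1 + 1 / (2 * ((y:ℝ) + 1))) by ring]
    rw [le_div_iff₀ hD]
    -- `(549/400)(√2 + 1 + 1/(2(y+1))) ≤ 8(√2−1)(1 + 1/(3y))`, times `y² ≥ 0`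
    have hineq : (549 / 400 : ℝ) * (Real.sqrt 2 + 1 + 1 / (2 * ((y:ℝ) + 1))) ≤ 8 * (Real.sqrt 2 - 1) * (1 + 1 / (3 * (y:ℝ))) := by
      have h1y : 1 / (2 * ((y:ℝ) + 1)) ≤ 1 / (2 * (y:ℝ)) := div_le_div_of_nonneg_left (by norm_num) (by positivity) (by linarith)
      have hyinv : 0 ≤ 1 / (y:ℝ) := by positivity
      have e3 : 1 / (2 * (y:ℝ)) = (1/2) * (1 / (y:ℝ)) := by field_simp
      have e4 : 1 / (3 * (y:ℝ)) = (1/3) * (1 / (y:ℝ)) := by field_simp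
      rw [e4]; nlinarith [e3, h1y]
    have hy2 : 0 ≤ (y:ℝ) ^ 2 := sq_nonneg _
    nlinarith [mul_le_mul_of_nonneg_right hineq hy2]
  linarith

end Summit.QuantumFields.BalabanUV.Beta.EriceRemainderEnclosureHistoryAutonomyComparisonAgeCompositionStaticChainAdjacentEnvelopes

end
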